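import Mathlib
import Summits.CriticalPhenomena.PercolationContinuityZ3.Theorems.PercNearOneGluingNoHeavyLowerTailTNKernels
import Summits.CriticalPhenomena.PercolationContinuityZ3.Theorems.PercNearOneGluingNoHeavyLowerTailBandTwoTN
import HarnessLib

/-!
# Routh chains of interleaved kernels are totally nonnegative

Support file for the Sahi / Conjecture-P programme of route `PercNearOneGluingNoHeavy`
(`--supports stmt-CriticalPhenomena-4575`, prover prim-l12-p5 gen 48; proof note
`prim-l12-p5/PROOF-DIFFERENCE-HURWITZ-g48.md` §2).  No definitions, no named facts, no sorries.
The difference–Hurwitz matrix of a pair of operators is the kernel on the doubled index `t` with rows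
`t = 2n ↦ X n`, `t = 2n+1 ↦ Y n`.  The DISCRETE ROUTH ALGORITHM of the memo produces a chain
`(X_k, Y_k)`, `k = 0..T`, with `X_k 0 = X_{k+1} 0`, `X_k (n+1) = X_{k+1} (n+1) + c_k (n+1) Y_k n` (the row
just above) and `Y_k n = Y_{k+1} n + cL_k X_{k+1} n + cU_k X_{k+1} (n+1)` (both neighbours), ending at
`X_T = κ·1`, `Y_T = 0`.  If `c, cL, cU, κ ≥ 0` the interleaved kernel of `(X_0, Y_0)` is totally nonnegative
(`DiffHurwitz.chain_tn`): every link is a left multiplication by a nonnegative unit lower/upper bidiagonal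
kernel with no `2×2` clash (`tridiagStep_tn`), and the terminal kernel is a multiple of a partial identity.
-/

namespace Summit.CriticalPhenomena.PercolationContinuityZ3.Theorems

namespace DiffHurwitz

open Finset Matrix

/-- Nonnegative unit UPPER bidiagonal kernels `(n,t) ↦ [t = n] + [t = n+1]·f n` are totally
nonnegative (transpose of the lower bidiagonal case, `BandTwoTN.bidiag_minor_nonneg`). -/
theorem upperBidiag_minor_nonneg (f : ℕ → ℝ) (hf : ∀ n, 0 ≤ f n)
    {k : ℕ} (r c : Fin k → ℕ) (hr : StrictMono r) (hc : StrictMono c) :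
    0 ≤ (Matrix.of fun i j =>
      if c j = r i then (1 : ℝ) else if c j = r i + 1 then f (r i) else 0).det := by
  have hT : (Matrix.of fun i j =>
      if c j = r i then (1 : ℝ) else if c j = r i + 1 then f (r i) else 0) =
      (Matrix.of fun i j =>
        if r j = c i then (1 : ℝ) else if r j + 1 = c i then f (c i - 1) else 0).transpose := by
    ext i j
    simp only [Matrix.transpose_apply, Matrix.of_apply]
    split_ifs <;> first
      | rfl
      | (exfalso; omega)
      | (congr 1; omega)
  rw [hT, Matrix.det_transpose]
  exact BandTwoTN.bidiag_minor_nonneg (fun _ => 1) (fun n => f (n - 1)) (fun _ => one_pos)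
    (fun n => hf _) c r hc hr

/-- **Up-step (banded Cauchy–Binet on the doubled index).**  If the kernel `M` is TN and `f ≥ 0`
with `f 0 = 0`, then `(t,l) ↦ M t l + f t · M (t+1) l` is TN. -/
theorem stepUp_tn (M : ℕ → ℕ → ℝ) (f : ℕ → ℝ) (hf : ∀ t, 0 ≤ f t) (hf0 : f 0 = 0)
    (hM : ∀ (k : ℕ) (r c : Fin k → ℕ), StrictMono r → StrictMono c →
      0 ≤ (Matrix.of fun i j => M (r i) (c j)).det)
    {k : ℕ} (r c : Fin k → ℕ) (hr : StrictMono r) (hc : StrictMono c) :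
    0 ≤ (Matrix.of fun i j => M (r i) (c j) + f (r i) * M (r i + 1) (c j)).det := by
  cases k with
  | zero => simp
  | succ k =>
    -- the upper bidiagonal factor, as a kernel
    set U : ℕ → ℕ → ℝ := fun n t => if t = n then (1 : ℝ) else if t = n + 1 then f n else 0 with hU
    have hUband : ∀ n t, 2 * n < t → U n t = 0 := by
      intro n t hnt
      rcases Nat.eq_zero_or_pos n with hn | hn
      · subst hn; rw [hU]; simp only
        rw [if_neg (by omega)]
        by_cases h : t = 0 + 1
        · rw [if_pos h, hf0]
        · rw [if_neg h]
      · rw [hU]; simp only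
        rw [if_neg (by omega), if_neg (by omega)]
    set R : ℕ := 2 * r (Fin.last k) + 1 with hR
    have hrR : ∀ i, 2 * r i < R := fun i =>
      Nat.lt_succ_of_le (Nat.mul_le_mul_left 2 (hr.monotone (Fin.le_last i)))
    let A' : Matrix (Fin (k + 1)) (Fin R) ℝ := Matrix.of fun i t => U (r i) t
    let B' : Matrix (Fin R) (Fin (k + 1)) ℝ := Matrix.of fun t j => M t (c j)
    have hsum : ∀ i j, ∑ t ∈ range R, U (r i) t * M t (c j) =
        M (r i) (c j) + f (r i) * M (r i + 1) (c j) := by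
      intro i j
      have hsplit : ∀ t, U (r i) t * M t (c j) =
          (if t = r i then M (r i) (c j) else 0)
            + (if t = r i + 1 then f (r i) * M (r i + 1) (c j) else 0) := by
        intro t
        rw [hU]; simp only
        by_cases h1 : t = r i
        · subst h1; rw [if_pos rfl, if_pos rfl, if_neg (by omega), one_mul, add_zero]
        · rw [if_neg h1, if_neg h1, zero_add]
          by_cases h2 : t = r i + 1
          · subst h2; rw [if_pos rfl, if_pos rfl]
          · rw [if_neg h2, if_neg h2, zero_mul]
      rw [Finset.sum_congr rfl (fun t _ => hsplit t), Finset.sum_add_distrib,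
        Finset.sum_ite_eq' (range R) (r i), if_pos (by rw [mem_range]; have := hrR i; omega),
        Finset.sum_ite_eq' (range R) (r i + 1)]
      rcases Nat.eq_zero_or_pos (r i) with hn | hn
      · by_cases hmem : r i + 1 ∈ range R
        · rw [if_pos hmem]
        · rw [if_neg hmem, hn, hf0, zero_mul]
      · rw [if_pos (by rw [mem_range]; have := hrR i; omega)]
    have hM' : (Matrix.of fun i j => M (r i) (c j) + f (r i) * M (r i + 1) (c j)) = A' * B' := by
      ext i j
      rw [Matrix.mul_apply, Matrix.of_apply, ← hsum i j,
        ← Fin.sum_univ_eq_sum_range (fun t => U (r i) t * M t (c j)) R]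
      rfl
    rw [hM', Literature.Analysis.TotalPositivity.det_mul_eq_sum_strictMono]
    refine Finset.sum_nonneg fun t ht => ?_
    rw [mem_filter] at ht
    have htm : StrictMono (fun j => ((t j : Fin R) : ℕ)) :=
      fun a b hab => Fin.lt_def.1 (ht.2 hab)
    refine mul_nonneg ?_ ?_
    · have : A'.submatrix id t = Matrix.of fun i j => U (r i) ((t j : Fin R) : ℕ) := by
        ext i j; rfl
      rw [this]
      have := upperBidiag_minor_nonneg f hf r (fun j => ((t j : Fin R) : ℕ)) hr htm
      rw [hU]
      exact this
    · have : B'.submatrix t id = Matrix.of fun i j => M ((t i : Fin R) : ℕ) (c j) := by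
        ext i j; rfl
      rw [this]
      exact hM (k + 1) (fun i => ((t i : Fin R) : ℕ)) c htm hc

/-- **Tridiagonal step without clash.**  If `M` is TN, `e, f ≥ 0`, `e 0 = f 0 = 0` and
`e (t+1) · f t = 0` for all `t`, then `(t,l) ↦ M t l + e t · M (t-1) l + f t · M (t+1) l` — left
multiplication by the unit tridiagonal kernel `I + L + U = (I + L)(I + U)` — is TN. -/
theorem tridiagStep_tn (M : ℕ → ℕ → ℝ) (e f : ℕ → ℝ) (he : ∀ t, 0 ≤ e t) (hf : ∀ t, 0 ≤ f t)
    (he0 : e 0 = 0) (hf0 : f 0 = 0) (hef : ∀ t, e (t + 1) * f t = 0)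
    (hM : ∀ (k : ℕ) (r c : Fin k → ℕ), StrictMono r → StrictMono c →
      0 ≤ (Matrix.of fun i j => M (r i) (c j)).det)
    {k : ℕ} (r c : Fin k → ℕ) (hr : StrictMono r) (hc : StrictMono c) :
    0 ≤ (Matrix.of fun i j =>
      M (r i) (c j) + e (r i) * M (r i - 1) (c j) + f (r i) * M (r i + 1) (c j)).det := by
  -- first the up-step …
  set M₁ : ℕ → ℕ → ℝ := fun t l => M t l + f t * M (t + 1) l with hM₁
  have h1 : ∀ (k : ℕ) (r c : Fin k → ℕ), StrictMono r → StrictMono c →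
      0 ≤ (Matrix.of fun i j => M₁ (r i) (c j)).det :=
    fun k r c hr hc => stepUp_tn M f hf hf0 hM r c hr hc
  -- … then the down-step (Cauchy–Binet with a lower bidiagonal left factor)
  have hrow : ∀ t l, M t l + e t * M (t - 1) l + f t * M (t + 1) l = M₁ t l + e t * M₁ (t - 1) l := by
    intro t l
    rcases t with _ | t
    · rw [he0]; simp [hM₁]
    · rw [hM₁]; simp only [Nat.add_sub_cancel]
      have := hef t
      rcases mul_eq_zero.1 this with h | h
      · rw [h]; ring
      · rw [h]; ring
  have heq : (Matrix.of fun i j =>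
      M (r i) (c j) + e (r i) * M (r i - 1) (c j) + f (r i) * M (r i + 1) (c j)) =
      Matrix.of fun i j => ∑ t ∈ range (r i + 1),
        (if t = r i then (1 : ℝ) else if t + 1 = r i then e (r i) else 0) * M₁ t (c j) := by
    ext i j
    rw [Matrix.of_apply, Matrix.of_apply, hrow,
      BandTwoTN.sum_bidiag (fun _ => (1 : ℝ)) e (fun t => M₁ t (c j)) he0 (r i), one_mul]
  rw [heq]
  set N := (univ.sup r) + (univ.sup c) + 1 with hN
  refine TNKernel.mulLower_minor_nonneg
    (fun n t => if t = n then (1 : ℝ) else if t + 1 = n then e n else 0)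
    M₁ N ?_ ?_ ?_ r c hr hc (fun i => ?_) (fun j => ?_)
  · intro k' r' c' hr' hc'
    exact BandTwoTN.bidiag_minor_nonneg (fun _ => 1) e (fun _ => one_pos) he r' c' hr' hc'
  · intro k' r' c' hr' hc' _ _
    exact h1 k' r' c' hr' hc'
  · intro n t hnt
    rw [if_neg (by omega), if_neg (by omega)]
  · have : r i ≤ univ.sup r := Finset.le_sup (f := r) (mem_univ i)
    omega
  · have : c j ≤ univ.sup c := Finset.le_sup (f := c) (mem_univ j)
    omega

/-- Parity bookkeeping, even rows: if `X' 0 = X 0` and `X' (n+1) = X (n+1) + a (n+1) · Y n`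
(`a 0 = 0`), then `interleave(X', Y) t = interleave(X, Y) t + [t even] a (t/2) · interleave(X, Y) (t-1)
+ 0 · interleave(X, Y) (t+1)`. -/
theorem interleave_even_step (X Y X' : ℕ → ℕ → ℝ) (a : ℕ → ℝ) (ha0 : a 0 = 0)
    (h0 : ∀ l, X' 0 l = X 0 l) (hS : ∀ n l, X' (n + 1) l = X (n + 1) l + a (n + 1) * Y n l)
    (t l : ℕ) :
    (if t % 2 = 0 then X' (t / 2) l else Y (t / 2) l) =
      (if t % 2 = 0 then X (t / 2) l else Y (t / 2) l)
        + (if t % 2 = 0 then a (t / 2) else 0)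
          * (if (t - 1) % 2 = 0 then X ((t - 1) / 2) l else Y ((t - 1) / 2) l)
        + 0 * (if (t + 1) % 2 = 0 then X ((t + 1) / 2) l else Y ((t + 1) / 2) l) := by
  rw [zero_mul, add_zero]
  rcases Nat.even_or_odd' t with ⟨n, rfl | rfl⟩
  · have h1 : (2 * n) % 2 = 0 := by omega
    rw [if_pos h1, if_pos h1, if_pos h1, show (2 * n) / 2 = n by omega]
    rcases n with _ | n
    · rw [ha0, zero_mul, add_zero]; exact h0 l
    · rw [if_neg (by omega), show (2 * (n + 1) - 1) / 2 = n by omega]; exact hS n l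
  · rw [if_neg (by omega), if_neg (by omega), if_neg (by omega), show (2 * n + 1) / 2 = n by omega,
      zero_mul, add_zero]

/-- Parity bookkeeping, odd rows: if `Y' n = Y n + b · X n + u · X (n+1)` then
`interleave(X, Y') t = interleave(X, Y) t + [t odd] b · interleave(X, Y) (t-1) + [t odd] u · interleave(X, Y) (t+1)`. -/
theorem interleave_odd_step (X Y Y' : ℕ → ℕ → ℝ) (b u : ℝ)
    (hS : ∀ n l, Y' n l = Y n l + b * X n l + u * X (n + 1) l) (t l : ℕ) :
    (if t % 2 = 0 then X (t / 2) l else Y' (t / 2) l) =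
      (if t % 2 = 0 then X (t / 2) l else Y (t / 2) l)
        + (if t % 2 = 0 then 0 else b)
          * (if (t - 1) % 2 = 0 then X ((t - 1) / 2) l else Y ((t - 1) / 2) l)
        + (if t % 2 = 0 then 0 else u)
          * (if (t + 1) % 2 = 0 then X ((t + 1) / 2) l else Y ((t + 1) / 2) l) := by
  rcases Nat.even_or_odd' t with ⟨n, rfl | rfl⟩
  · have h1 : (2 * n) % 2 = 0 := by omega
    rw [if_pos h1, if_pos h1, if_pos h1, if_pos h1, zero_mul, zero_mul, add_zero, add_zero]
  · have hodd : ¬ (2 * n + 1) % 2 = 0 := by omega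
    rw [if_neg hodd, if_neg hodd, if_neg hodd, if_neg hodd,
      if_pos (show (2 * n + 1 - 1) % 2 = 0 by omega), if_pos (show (2 * n + 1 + 1) % 2 = 0 by omega),
      show (2 * n + 1) / 2 = n by omega, show (2 * n + 1 - 1) / 2 = n by omega,
      show (2 * n + 1 + 1) / 2 = n + 1 by omega]
    exact hS n l

/-- The terminal kernel `interleave(κ·1, 0)` (`κ ≥ 0`) is totally nonnegative: it is `κ` times the
partial identity `[t = 2l]`, whose minors are minors of the identity kernel. -/
theorem terminal_tn (κ : ℝ) (hκ : 0 ≤ κ) {k : ℕ} (r c : Fin k → ℕ) (hr : StrictMono r)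
    (hc : StrictMono c) :
    0 ≤ (Matrix.of fun i j =>
      if r i % 2 = 0 then (if c j = r i / 2 then κ else 0) else (0 : ℝ)).det := by
  have hc2 : StrictMono (fun j => 2 * c j) := fun a b hab => by have := hc hab; simp only; omega
  have hid := BandTwoTN.bidiag_minor_nonneg (fun _ => (1 : ℝ)) (fun _ => 0) (fun _ => one_pos)
    (fun _ => le_rfl) r (fun j => 2 * c j) hr hc2
  have heq : (Matrix.of fun i j =>
      if r i % 2 = 0 then (if c j = r i / 2 then κ else 0) else (0 : ℝ)) =
      κ • (Matrix.of fun i j =>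
        if 2 * c j = r i then (1 : ℝ) else if 2 * c j + 1 = r i then 0 else 0) := by
    ext i j
    simp only [Matrix.smul_apply, Matrix.of_apply, smul_eq_mul, ite_self]
    by_cases h : 2 * c j = r i
    · rw [if_pos h, if_pos (by omega), if_pos (by omega), mul_one]
    · rw [if_neg h, mul_zero]
      by_cases h' : r i % 2 = 0
      · rw [if_pos h', if_neg (by omega)]
      · rw [if_neg h']
  rw [heq, Matrix.det_smul]
  exact mul_nonneg (pow_nonneg hκ _) hid

/-- **Routh chains are totally nonnegative.**  Let `X_k, Y_k` (`k = 0..T`) be kernels with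
`X_k 0 = X_{k+1} 0`, `X_k (n+1) = X_{k+1} (n+1) + c_k (n+1) Y_k n`,
`Y_k n = Y_{k+1} n + cL_k X_{k+1} n + cU_k X_{k+1} (n+1)` for `k < T`, with `c, cL, cU ≥ 0`, and
`X_T n l = [l = n] κ` (`κ ≥ 0`), `Y_T = 0`.  Then the interleaved kernel `t = 2n ↦ X_0 n`,
`t = 2n+1 ↦ Y_0 n` is totally nonnegative. -/
theorem chain_tn (T : ℕ) (X Y : ℕ → ℕ → ℕ → ℝ) (c cL cU : ℕ → ℝ) (κ : ℝ) (hκ : 0 ≤ κ)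
    (hc : ∀ k, 0 ≤ c k) (hcL : ∀ k, 0 ≤ cL k) (hcU : ∀ k, 0 ≤ cU k)
    (hA0 : ∀ k, k < T → ∀ l, X k 0 l = X (k + 1) 0 l)
    (hA : ∀ k, k < T → ∀ n l, X k (n + 1) l = X (k + 1) (n + 1) l + c k * (n + 1) * Y k n l)
    (hB : ∀ k, k < T → ∀ n l,
      Y k n l = Y (k + 1) n l + cL k * X (k + 1) n l + cU k * X (k + 1) (n + 1) l)
    (hXT : ∀ n l, X T n l = if l = n then κ else 0) (hYT : ∀ n l, Y T n l = 0)
    {m : ℕ} (r s : Fin m → ℕ) (hr : StrictMono r) (hs : StrictMono s) :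
    0 ≤ (Matrix.of fun i j =>
      if r i % 2 = 0 then X 0 (r i / 2) (s j) else Y 0 (r i / 2) (s j)).det := by
  have main : ∀ j, j ≤ T → ∀ (m : ℕ) (r s : Fin m → ℕ), StrictMono r → StrictMono s →
      0 ≤ (Matrix.of fun i j' =>
        if r i % 2 = 0 then X (T - j) (r i / 2) (s j') else Y (T - j) (r i / 2) (s j')).det := by
    intro j
    induction j with
    | zero =>
      intro _ m r s hr hs
      have heq : (Matrix.of fun i j' =>
          if r i % 2 = 0 then X (T - 0) (r i / 2) (s j') else Y (T - 0) (r i / 2) (s j')) =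
          Matrix.of fun i j' =>
            if r i % 2 = 0 then (if s j' = r i / 2 then κ else 0) else (0 : ℝ) := by
        ext i j'
        simp only [Matrix.of_apply, Nat.sub_zero, hXT, hYT]
      rw [heq]
      exact terminal_tn κ hκ r s hr hs
    | succ j ih =>
      intro hj m r s hr hs
      set k := T - (j + 1) with hk
      have hkT : k < T := by omega
      have hk1 : T - j = k + 1 := by omega
      have IH : ∀ (m : ℕ) (r s : Fin m → ℕ), StrictMono r → StrictMono s →
          0 ≤ (Matrix.of fun i j' => if r i % 2 = 0 then X (k + 1) (r i / 2) (s j')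
            else Y (k + 1) (r i / 2) (s j')).det := by
        intro m r s hr hs
        have := ih (by omega) m r s hr hs
        rw [hk1] at this
        exact this
      -- stage 1 (odd rows, both neighbours): Y k n = Y (k+1) n + cL k X (k+1) n + cU k X (k+1) (n+1)
      have P1 : ∀ (m : ℕ) (r s : Fin m → ℕ), StrictMono r → StrictMono s →
          0 ≤ (Matrix.of fun i j' => if r i % 2 = 0 then X (k + 1) (r i / 2) (s j')
            else Y k (r i / 2) (s j')).det := by
        intro m r s hr hs
        have heq : (Matrix.of fun i j' => if r i % 2 = 0 then X (k + 1) (r i / 2) (s j')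
            else Y k (r i / 2) (s j')) =
            Matrix.of fun i j' =>
              (if r i % 2 = 0 then X (k + 1) (r i / 2) (s j') else Y (k + 1) (r i / 2) (s j'))
              + (if r i % 2 = 0 then 0 else cL k)
                * (if (r i - 1) % 2 = 0 then X (k + 1) ((r i - 1) / 2) (s j')
                    else Y (k + 1) ((r i - 1) / 2) (s j'))
              + (if r i % 2 = 0 then 0 else cU k)
                * (if (r i + 1) % 2 = 0 then X (k + 1) ((r i + 1) / 2) (s j')
                    else Y (k + 1) ((r i + 1) / 2) (s j')) := by
          ext i j'
          rw [Matrix.of_apply, Matrix.of_apply]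
          exact interleave_odd_step (X (k + 1)) (Y (k + 1)) (Y k) (cL k) (cU k) (hB k hkT) (r i) (s j')
        rw [heq]
        refine tridiagStep_tn
          (fun t l => if t % 2 = 0 then X (k + 1) (t / 2) l else Y (k + 1) (t / 2) l)
          (fun t => if t % 2 = 0 then 0 else cL k) (fun t => if t % 2 = 0 then 0 else cU k)
          (fun t => by by_cases h : t % 2 = 0 <;> simp [h, hcL k])
          (fun t => by by_cases h : t % 2 = 0 <;> simp [h, hcU k]) (by norm_num) (by norm_num)
          (fun t => ?_) IH r s hr hs
        by_cases h : t % 2 = 0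
        · rw [if_neg (by omega), if_pos h, mul_zero]
        · rw [if_pos (by omega), zero_mul]
      -- stage 2 (even rows, the row just above): X k (n+1) = X (k+1) (n+1) + c k (n+1) · Y k n
      have heq : (Matrix.of fun i j' => if r i % 2 = 0 then X k (r i / 2) (s j')
          else Y k (r i / 2) (s j')) =
          Matrix.of fun i j' =>
            (if r i % 2 = 0 then X (k + 1) (r i / 2) (s j') else Y k (r i / 2) (s j'))
            + (if r i % 2 = 0 then c k * ((r i / 2 : ℕ) : ℝ) else 0)
              * (if (r i - 1) % 2 = 0 then X (k + 1) ((r i - 1) / 2) (s j')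
                  else Y k ((r i - 1) / 2) (s j'))
            + (fun _ => (0 : ℝ)) (r i)
              * (if (r i + 1) % 2 = 0 then X (k + 1) ((r i + 1) / 2) (s j')
                  else Y k ((r i + 1) / 2) (s j')) := by
        ext i j'
        rw [Matrix.of_apply, Matrix.of_apply]
        refine interleave_even_step (X (k + 1)) (Y k) (X k) (fun n => c k * (n : ℝ)) (by simp)
          (hA0 k hkT) (fun n l => ?_) (r i) (s j')
        rw [hA k hkT n l]; push_cast; ring
      rw [heq]
      exact tridiagStep_tn (fun t l => if t % 2 = 0 then X (k + 1) (t / 2) l else Y k (t / 2) l)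
        (fun t => if t % 2 = 0 then c k * ((t / 2 : ℕ) : ℝ) else 0) (fun _ => 0)
        (fun t => by
          by_cases h : t % 2 = 0
          · rw [if_pos h]; exact mul_nonneg (hc k) (Nat.cast_nonneg _)
          · rw [if_neg h])
        (fun _ => le_rfl) (by norm_num) rfl (fun _ => mul_zero _) P1 r s hr hs
  simpa only [Nat.sub_self] using main T le_rfl m r s hr hs

end DiffHurwitz

end Summit.CriticalPhenomena.PercolationContinuityZ3.Theorems
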